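import Summits.BirchSwinnertonDyer.BirchSwinnertonDyer.Theorems.GenusKolyvaginAtTwoPowDvdShaCardAtTwoRTExactSwapCoreFrob
import Summits.BirchSwinnertonDyer.BirchSwinnertonDyer.Theorems.CMKolyvaginAtInertTwoLowerCebotarevAtTwo
import Summits.BirchSwinnertonDyer.BirchSwinnertonDyer.Theorems.CMKolyvaginAtInertTwoLowerRungSupplyAtTwo
import HarnessLib

/-!
# Route `CMKolyvaginAtInertTwo`, crux `CMKolyvaginExactAtInertTwo` (stmt-BirchSwinnertonDyer-24277), `stub_lower` —
# PORT OF gk2's LINE 18, FILE C2a: THE EXACT PRIME SWAP AT `2` (McCallum Prop. 5.2's step), core form, ON THE CM-INERT HABITAT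

Seat `bsd-line-cmk2-p1` g19 (cell `bsd-print-cf2`), `--supports stmt-BirchSwinnertonDyer-24277` (helper; closes nothing).
THEOREMS ONLY (no definition, no named fact, no `sorry`).  BSD is NOT proved by any of this; the crux is not closed here.

WHAT.  LEAD gk2-p1 g18's `PlusDescent.exactSwap_core_frob` (`…RTExactSwapCoreFrob`; the DROPS socket `hswap` of the KS assembly is its
frame-instantiated form) is typed on the frame «`¬ HasCM`, `Δ < 0`, `ρ_{E,2^∞}` onto, `d_K·(−|Δ|) ∉ ℚ²`, Q2, (NPh_{M+k})» plus the displayed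
local sockets P4/P5/P7a⁼/P7b⁼/T2/P8.  Reading the proof: the image binders serve (1) the deep full-order pair Čebotarev for `(c_M(n), w)`
with its separation hypothesis fed by (NPh) and the Selmer conditions of `c`, `w` over `2N`, (2) Q2 at the fresh prime `ℓ` and at the
swapped-out prime `a` (`kolyvaginRelationAtTwo_cast`), (3) `ρ̄₂` onto for the sign law.  On H₂ (1) is file B0's deep pair theorem WITHOUT
`hres`, (2) is file A's per-instance relation from Gross 1991 Prop. 3.7 (2).  So the core swap holds with the H₂ binders and WITHOUT (NPh);
everything else (KRR's `swapPlaces`, `localTatePairing_add_eq_zero_of_swap`, the data triple, the equal-exponent contradiction) is unchanged.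
Proof VERBATIM minus the separation paragraph (credit LEAD gk2-p1 g18; gk2-p3 g23 for the Frobenius binder; KRR for the pieces).

References: [McCallumLMS1991] §5 Prop. 5.2 (proof, pp. 308–310), Lemma 5.3, Prop. 4.4; [Kolyvagin1991MathAnn] §2 Thm. 2.2; [GrossLMS1991]
Prop. 3.7 (2), Prop. 6.2.
-/

set_option autoImplicit false
set_option linter.dupNamespace false

noncomputable section

open scoped Classical Pointwise
open Function NumberField IsDedekindDomain WeierstrassCurve Field
open Literature.NumberTheory.EllipticCurves Literature.NumberTheory.GaloisRepresentations
open Literature.NumberTheory.EllipticCurves.Jetchev2008 Literature.NumberTheory.EllipticCurves.ModularForms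
open Literature.NumberTheory.GaloisCohomology
open Literature.NumberTheory.EllipticCurves.GrossLMS1991 (prop37_2_reductionCongruence_inert)
open Literature.NumberTheory.GaloisRepresentations.DiscreteGaloisModule (localTatePairingZMod
  tateDual SelmerStructure)
open Summit.BirchSwinnertonDyer.Rank1Residual.JET.SelmerVocabulary
open Summit.BirchSwinnertonDyer.Rank1Residual.JET.GlobalDuality
open Summit.BirchSwinnertonDyer.BirchSwinnertonDyer.Theorems.KolyvaginLowerBoundAtTwo
open Summit.BirchSwinnertonDyer.BirchSwinnertonDyer.Theorems.GenusExact
open Summit.BirchSwinnertonDyer.BirchSwinnertonDyer.Theorems.GenusExact.PlusDescent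

namespace Summit.BirchSwinnertonDyer.BirchSwinnertonDyer.Theorems.KolyvaginLowerTwo

section Frame

variable {K : Type} [Field K] [NumberField K] (W : WeierstrassCurve ℚ) [W.IsElliptic]
  [W.IsGloballyMinimal] [(W.baseChange K).IsElliptic] [NeZero (W.conductorNorm ℤ)]
  [∀ M : ℕ, NeZero (2 ^ M)] [∀ M : ℕ, Finite (geomTorsion (W.baseChange K) ((2 ^ M : ℕ) : ℤ))]
  (τ : K ≃ₐ[ℚ] K)
  (Dt : ModularParametrizationData W (W.conductorNorm ℤ)) (β : ℤ) (ι : K →+* ℂ)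
  (e : ∀ M : ℕ, geomTorsion (W.baseChange K) ((2 ^ M : ℕ) : ℤ) →
    geomTorsion (W.baseChange K) ((2 ^ M : ℕ) : ℤ) → AlgebraicClosure K)
  (hμ : ∀ M S T, e M S T ^ (2 ^ M) = 1)
  (hadd₁ : ∀ M S₁ S₂ T, e M (S₁ + S₂) T = e M S₁ T * e M S₂ T)
  (hadd₂ : ∀ M S T₁ T₂, e M S (T₁ + T₂) = e M S T₁ * e M S T₂)
  (hgal : ∀ M (g : absoluteGaloisGroup K) (S T : geomTorsion (W.baseChange K) ((2 ^ M : ℕ) : ℤ)),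
    g • e M S T = e M (g • S) (g • T))
  (halt : ∀ M T, e M T T = 1) (hnondeg : ∀ M T, (∀ S, e M S T = 1) → T = 0)
  (inv : ∀ M : ℕ, LocalInvariants K (2 ^ M))
  (𝒯 : ∀ M : ℕ, SelmerStructure ((W.baseChange K).torsionGaloisModule ((2 ^ M : ℕ) : ℤ)))
  (hCM : W.HasCM) (hin : Rank1Residual.CMInert W 2)
  (hρ2 : W.HasSurjectiveModNGaloisRep 2) (hK : IsImaginaryQuadratic K)
  (hodd : Odd (NumberField.discr K)) (hne3 : NumberField.discr K ≠ -3)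
  (hHN : SatisfiesHeegnerHypothesis (W.conductorNorm ℤ) K)
  (h37 : prop37_2_reductionCongruence_inert (W.conductorNorm ℤ) W K)
  (hτ1 : τ ≠ 1)
  (hperf : ∀ M, (inv M).IsPerfect) (hvan : ∀ M, (inv M).SumLocalTermEqZero)
  (h𝒯sd : ∀ (M c : ℕ), ∀ v ∈ placesDividing K c,
    (inv M).dualTransported (𝒯 M) (weilDualIntertwining (W.baseChange K) (2 ^ M) (e M) (hμ M) (hadd₁ M)
      (hadd₂ M) (hgal M)) (Sum.inr v) = 𝒯 M (Sum.inr v))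
  (hP4 : ∀ (M c : ℕ) (dat : KolyvaginHeegnerData Dt β ι c),
    KolyvaginDescent.KolSupp (Zhang2014.IsKolyvaginPrime (W.conductorNorm ℤ) W K 2) c → 1 ≤ M →
    (∀ q ∈ c.primeFactors, M + 1 ≤ Zhang2014.kolyvaginIndex W 2 q) →
    ∀ w ∈ placesDividing K c,
      galoisCohomology.localization ((W.baseChange K).torsionGaloisModule ((2 ^ M : ℕ) : ℤ)) (Sum.inr w) 1
        (dat.kolyvaginClass Nat.prime_two M) ∈ 𝒯 M (Sum.inr w))
  (hP5 : ∀ (M m a : ℕ) (v₀ : HeightOneSpectrum (𝓞 K)) (s : ℤ), (s = 1 ∨ s = -1) → 9 ≤ M →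
    KolyvaginDescent.KolSupp (Zhang2014.IsKolyvaginPrime (W.conductorNorm ℤ) W K 2) m →
    (∀ q ∈ m.primeFactors, M + 1 ≤ Zhang2014.kolyvaginIndex W 2 q) →
    Zhang2014.IsKolyvaginPrime (W.conductorNorm ℤ) W K 2 a → M + 1 ≤ Zhang2014.kolyvaginIndex W 2 a →
    ¬ a ∣ m → ((a : ℕ) : 𝓞 K) ∈ v₀.asIdeal →
    ∃ w : galoisCohomology ((W.baseChange K).torsionGaloisModule ((2 ^ M : ℕ) : ℤ)) 1,
      w ∈ signPart W K τ ((2 ^ M : ℕ) : ℤ) s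
        (((selmerF W ((2 ^ M : ℕ) : ℤ) (𝒯 M) (placesDividing K m)).relaxedAt {v₀}).selmerGroup) ∧
      ((2 ^ (M / 2 - 5) : ℕ) : ℤ) • w ≠ 0)
  (hP7a : ∀ (M M' ℓ : ℕ) (v : HeightOneSpectrum (𝓞 K))
    (w C : galoisCohomology ((W.baseChange K).torsionGaloisModule ((2 ^ M : ℕ) : ℤ)) 1) (s : ℤ) (a b : ℕ),
    (s = 1 ∨ s = -1) → Zhang2014.IsKolyvaginPrime (W.conductorNorm ℤ) W K 2 ℓ →
    M ≤ Zhang2014.kolyvaginIndex W 2 ℓ → M ≤ M' → FrobEqFrobInfty W K (2 ^ M') ℓ →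
    ((ℓ : ℕ) : 𝓞 K) ∈ v.asIdeal →
    conjAct W τ ((2 ^ M : ℕ) : ℤ) w = s • w → conjAct W τ ((2 ^ M : ℕ) : ℤ) C = s • C →
    galoisCohomology.localization ((W.baseChange K).torsionGaloisModule ((2 ^ M : ℕ) : ℤ)) (Sum.inr v) 1 w ∈
      (W.baseChange K).kummerSelmerStructure ((2 ^ M : ℕ) : ℤ) (Sum.inr v) →
    ((2 ^ a : ℕ) : ℤ) • galoisCohomology.localization ((W.baseChange K).torsionGaloisModule ((2 ^ M : ℕ) : ℤ))
      (Sum.inr v) 1 w ≠ 0 →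
    ((2 ^ b : ℕ) : ℤ) • galoisCohomology.localization ((W.baseChange K).torsionGaloisModule ((2 ^ M : ℕ) : ℤ))
      (Sum.inr v) 1 C ∉ (W.baseChange K).kummerSelmerStructure ((2 ^ M : ℕ) : ℤ) (Sum.inr v) →
    M ≤ a + b →
    (2 ^ (a + b - M) : ℕ) •
        localTatePairingZMod ((W.baseChange K).torsionGaloisModule ((2 ^ M : ℕ) : ℤ)) (2 ^ M) (Sum.inr v)
          (inv M (Sum.inr v))
          (galoisCohomology.localization ((W.baseChange K).torsionGaloisModule ((2 ^ M : ℕ) : ℤ)) (Sum.inr v) 1 w)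
          (galoisCohomology.localization (((W.baseChange K).torsionGaloisModule ((2 ^ M : ℕ) : ℤ)).tateDual (2 ^ M))
            (Sum.inr v) 1
            (galoisCohomology.map (weilDualIntertwining (W.baseChange K) (2 ^ M) (e M) (hμ M) (hadd₁ M) (hadd₂ M)
              (hgal M)) 1 C)) ≠ 0)
  (hP7b : ∀ (M M' q : ℕ) (v : HeightOneSpectrum (𝓞 K))
    (w C : galoisCohomology ((W.baseChange K).torsionGaloisModule ((2 ^ M : ℕ) : ℤ)) 1) (s : ℤ) (a₀ b₀ : ℕ),
    (s = 1 ∨ s = -1) → Zhang2014.IsKolyvaginPrime (W.conductorNorm ℤ) W K 2 q →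
    M + 1 ≤ Zhang2014.kolyvaginIndex W 2 q → M ≤ M' → FrobEqFrobInfty W K (2 ^ M') q → ((q : ℕ) : 𝓞 K) ∈ v.asIdeal →
    conjAct W τ ((2 ^ M : ℕ) : ℤ) w = s • w → conjAct W τ ((2 ^ M : ℕ) : ℤ) C = s • C →
    galoisCohomology.localization ((W.baseChange K).torsionGaloisModule ((2 ^ M : ℕ) : ℤ)) (Sum.inr v) 1 C ∈
      𝒯 M (Sum.inr v) →
    ((2 ^ a₀ : ℕ) : ℤ) • galoisCohomology.localization ((W.baseChange K).torsionGaloisModule ((2 ^ M : ℕ) : ℤ))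
      (Sum.inr v) 1 w ∈ 𝒯 M (Sum.inr v) →
    ((2 ^ b₀ : ℕ) : ℤ) • galoisCohomology.localization ((W.baseChange K).torsionGaloisModule ((2 ^ M : ℕ) : ℤ))
      (Sum.inr v) 1 C = 0 →
    (2 ^ (a₀ + b₀ - M - 1) : ℕ) •
        localTatePairingZMod ((W.baseChange K).torsionGaloisModule ((2 ^ M : ℕ) : ℤ)) (2 ^ M) (Sum.inr v)
          (inv M (Sum.inr v))
          (galoisCohomology.localization ((W.baseChange K).torsionGaloisModule ((2 ^ M : ℕ) : ℤ)) (Sum.inr v) 1 w)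
          (galoisCohomology.localization (((W.baseChange K).torsionGaloisModule ((2 ^ M : ℕ) : ℤ)).tateDual (2 ^ M))
            (Sum.inr v) 1
            (galoisCohomology.map (weilDualIntertwining (W.baseChange K) (2 ^ M) (e M) (hμ M) (hadd₁ M) (hadd₂ M)
              (hgal M)) 1 C)) = 0)
  (hT2 : ∀ (n : ℕ) (d : KolyvaginHeegnerData Dt β ι n) (M : ℕ),
    KolyvaginDescent.KolSupp (Zhang2014.IsKolyvaginPrime (W.conductorNorm ℤ) W K 2) n →
    1 ≤ M → (M : ℕ∞) ≤ Zhang2014.levelIndex W 2 n →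
    ∀ v : HeightOneSpectrum (𝓞 K), ((n : ℕ) : 𝓞 K) ∉ v.asIdeal →
      ((2 ^ 0 : ℕ) : ℤ) • d.kolyvaginClass Nat.prime_two M ∈
        selmerLocalKer (W.baseChange K) (v.adicCompletion K) ((2 ^ M : ℕ) : ℤ))

include halt hnondeg hCM hin hρ2 hK hodd hne3 hHN hτ1 hperf hvan h𝒯sd hP4 hP5 hP7a hP7b h37 hT2 in
/-- **THE EXACT PRIME SWAP AT `2` (McCallum Prop. 5.2, proof step), core form, ON THE CM-INERT HABITAT.**  LEAD gk2-p1 g18's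
`PlusDescent.exactSwap_core_frob` with the frame binders `(hCM : ¬HasCM) (hΔ) (hsur : ρ_{2^∞} onto) (hns) (hQ2)` replaced by
`(hCM : HasCM) (hin : CMInert W 2) (hρ2 : ρ̄₂ onto) (h37 : Gross 3.7 (2) at (W, K))` and the non-phantom hypothesis (NPh) REMOVED: the deep
full-order pair Čebotarev is file B0's `infinite_kolyvaginPrime_localization_fullOrder_pair_deep_of_cmInert` (no separation hypothesis on
H₂), Q2 at `ℓ` and at `a` are file A's per-instance relation.  From a square-free product `n` of Kolyvagin primes of index `≥ M+1`, `a ∣ n`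
with `Frob_a = Frob_∞` on `K(E[2^(M+k)])`, a datum at `n` whose class `c_M(n)` has EXACT order `2^g` (`g ≥ 1`), room `M + 6 ≤ M/2 + g`, extra
depth `k ≥ 1`: a fresh Kolyvagin prime `ℓ ∉ X`, `ℓ ∤ n`, of index `≥ M+k` with `Frob_ℓ = Frob_∞` on `K(E[2^(M+k)])`, at whose places
`2^(g−1) c_M(n)` is locally non-zero, and a datum at `n/a·ℓ` with `2^(g−1) • c_M(n/a·ℓ) ≠ 0` (no loss).  Displayed frame sockets P4/P5/P7a⁼/
P7b⁼/T2/P8 exactly as in gk2's statement; proof VERBATIM otherwise (credit LEAD gk2-p1 g18, gk2-p3 g23, KRR).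
[cite: McCallumLMS1991, §5 Prop. 5.2 (proof), Lemma 5.3, Prop. 4.4] [cite: Kolyvagin1991MathAnn, §2 Thm. 2.2] [cite: GrossLMS1991, Prop. 3.7 (2)] -/
theorem exactSwap_core_frob {M k g n a : ℕ} (X : Finset ℕ) (dat : KolyvaginHeegnerData Dt β ι n)
    (hM : 12 ≤ M) (hk : 1 ≤ k) (hn : Squarefree n)
    (hnK : ∀ p ∈ n.primeFactors, Zhang2014.IsKolyvaginPrime (W.conductorNorm ℤ) W K 2 p ∧
      M + 1 ≤ Zhang2014.kolyvaginIndex W 2 p)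
    (ha : a ∈ n.primeFactors) (haF : FrobEqFrobInfty W K (2 ^ (M + k)) a)
    (hg : 1 ≤ g) (hord : addOrderOf (dat.kolyvaginClass Nat.prime_two M) = 2 ^ g)
    (hroom : M + 6 ≤ M / 2 + g) :
    ∃ ℓ : ℕ, ℓ ∉ X ∧ ℓ ∉ n.primeFactors ∧ Zhang2014.IsKolyvaginPrime (W.conductorNorm ℤ) W K 2 ℓ ∧
      M + k ≤ Zhang2014.kolyvaginIndex W 2 ℓ ∧ FrobEqFrobInfty W K (2 ^ (M + k)) ℓ ∧
      (∀ v : HeightOneSpectrum (𝓞 K), ((ℓ : ℕ) : 𝓞 K) ∈ v.asIdeal →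
        ((2 ^ (g - 1) : ℕ) : ℤ) • dat.kolyvaginClass Nat.prime_two M ∉
          (W.baseChange K).torsionLocalKer (v.adicCompletion K) ((2 ^ M : ℕ) : ℤ)) ∧
      ∃ dat' : KolyvaginHeegnerData Dt β ι (n / a * ℓ),
        ((2 ^ (g - 1) : ℕ) : ℤ) • dat'.kolyvaginClass Nat.prime_two M ≠ 0 := by
  classical
  haveI : Fact (Nat.Prime 2) := ⟨Nat.prime_two⟩
  have hM1 : 1 ≤ M := by omega
  have hne4 : NumberField.discr K ≠ -4 := fun h ↦ by
    rw [h] at hodd; have := Int.odd_iff.mp hodd; omega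
  have hsur1 : W.HasSurjectiveModNGaloisRep ((2 : ℤ) ^ 1) := by simpa using hρ2
  have hn0 : n ≠ 0 := hn.ne_zero
  have hap : a.Prime := Nat.prime_of_mem_primeFactors ha
  have han : a ∣ n := Nat.dvd_of_mem_primeFactors ha
  have hKola : Zhang2014.IsKolyvaginPrime (W.conductorNorm ℤ) W K 2 a := (hnK a ha).1
  have hidxa : M + 1 ≤ Zhang2014.kolyvaginIndex W 2 a := (hnK a ha).2
  have hnK' : ∀ p ∈ n.primeFactors, Zhang2014.IsKolyvaginPrime (W.conductorNorm ℤ) W K 2 p ∧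
      M ≤ Zhang2014.kolyvaginIndex W 2 p := fun p hp ↦ ⟨(hnK p hp).1, Nat.le_of_succ_le (hnK p hp).2⟩
  have hmn : n / a ∣ n := Nat.div_dvd_of_dvd han
  have hm : Squarefree (n / a) := hn.squarefree_of_dvd hmn
  have hm0 : n / a ≠ 0 := hm.ne_zero
  have hmpf : ∀ q ∈ (n / a).primeFactors, q ∈ n.primeFactors :=
    fun q hq ↦ Nat.primeFactors_mono hmn hn0 hq
  have ham : a ∉ (n / a).primeFactors := by
    intro h
    have hdvd₂ : a * a ∣ n := by
      have := Nat.mul_dvd_mul_left a (Nat.dvd_of_mem_primeFactors h)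
      rwa [Nat.mul_div_cancel' han] at this
    exact hap.one_lt.ne' (Nat.isUnit_iff.mp (hn a hdvd₂))
  have hadvm : ¬ a ∣ n / a := fun h ↦ ham (Nat.mem_primeFactors.mpr ⟨hap, h, hm0⟩)
  have hmKol : KolyvaginDescent.KolSupp (Zhang2014.IsKolyvaginPrime (W.conductorNorm ℤ) W K 2) (n / a) :=
    ⟨hm, fun q hq ↦ (hnK q (hmpf q hq)).1⟩
  have hmidx : ∀ q ∈ (n / a).primeFactors, M + 1 ≤ Zhang2014.kolyvaginIndex W 2 q :=
    fun q hq ↦ (hnK q (hmpf q hq)).2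
  obtain ⟨v₀, hv₀⟩ : ∃ v : HeightOneSpectrum (𝓞 K), ((a : ℕ) : 𝓞 K) ∈ v.asIdeal :=
    ⟨⟨Ideal.span {((a : ℕ) : 𝓞 K)}, hKola.2.2.2.2.1, by
        rw [Ne, Ideal.span_singleton_eq_bot]; exact_mod_cast hap.ne_zero⟩,
      Ideal.mem_span_singleton_self _⟩
  set c := dat.kolyvaginClass Nat.prime_two M with hc_def
  have hMc : ((2 ^ M : ℕ) : ℤ) • c = 0 := zsmul_galH1Torsion_eq_zero _ _ _
  have hgc : ((2 ^ g : ℕ) : ℤ) • c = 0 := by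
    rw [natCast_zsmul, ← hord]; exact addOrderOf_nsmul_eq_zero c
  have hjc : ((2 ^ (g - 1) : ℕ) : ℤ) • c ≠ 0 := fun h ↦ by
    have hdvd := addOrderOf_dvd_of_nsmul_eq_zero ((natCast_zsmul c (2 ^ (g - 1))).symm.trans h)
    rw [hord, Nat.pow_dvd_pow_iff_le_right (by norm_num)] at hdvd; omega
  have hc0 : c ≠ 0 := fun h ↦ hjc (by rw [h, zsmul_zero])
  have hgM : g ≤ M := by
    by_contra h
    apply hjc
    exact two_pow_zsmul_eq_zero_of_le_swap (by omega) hMc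
  obtain ⟨hεn, hcsign⟩ := KolyvaginClassSign.sign_conjAct_kolyvaginClass_two hK hne3 hne4 hodd hHN hsur1 τ hτ1
    Dt β ι hn hM1 hnK' dat
  set εn : ℤ := -W.rootNumber * (-1) ^ n.primeFactors.card with hεn_def
  set ε' : ℤ := -εn with hε'_def
  have hε' : ε' = 1 ∨ ε' = -1 := by
    rcases hεn with h | h
    · exact Or.inr (by rw [hε'_def, h])
    · exact Or.inl (by rw [hε'_def, h]; norm_num)
  obtain ⟨w, hwsign, hword⟩ := hP5 M (n / a) a v₀ ε' hε' (by omega) hmKol hmidx hKola hidxa hadvm hv₀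
  obtain ⟨hwF, hwτ⟩ := (mem_signPart_iff W K τ _ _ _ w).mp hwsign
  have hMw : ((2 ^ M : ℕ) : ℤ) • w = 0 := zsmul_galH1Torsion_eq_zero (W.baseChange K) _ w
  obtain ⟨u, hru, huM, hu0, hu1⟩ := exists_two_pow_orderExp_swap w hMw hword
  have hu_one : 1 ≤ u := by omega
  have hwu : addOrderOf w = 2 ^ u := addOrderOf_eq_two_pow_of_zsmul_swap hu_one hu0 hu1
  have hw0 : w ≠ 0 := fun h ↦ hword (by rw [h, zsmul_zero])
  have hinf := KolyvaginLowerTwo.infinite_kolyvaginPrime_localization_fullOrder_pair_deep_of_cmInert W K hCM hin hρ2 hK hHN τ hτ1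
    M k hM1 c w hg hu_one hord hwu hεn hε' hcsign hwτ
  obtain ⟨ℓ, hℓmem, hℓE⟩ := hinf.exists_notMem_finset (X ∪ n.primeFactors)
  obtain ⟨hfrob, hKolℓ, hIℓ, hlocℓ⟩ := hℓmem
  rw [Finset.mem_union, not_or] at hℓE
  obtain ⟨hℓX, hℓn⟩ := hℓE
  have hℓp : ℓ.Prime := hKolℓ.1
  have hℓ0 : ℓ ≠ 0 := hℓp.ne_zero
  have hℓdvd : ¬ ℓ ∣ n := fun h ↦ hℓn (Nat.mem_primeFactors.mpr ⟨hℓp, h, hn0⟩)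
  have hMℓ : M ≤ Zhang2014.kolyvaginIndex W 2 ℓ := le_trans (by omega) hIℓ
  have hM1ℓ : M + 1 ≤ Zhang2014.kolyvaginIndex W 2 ℓ := le_trans (by omega) hIℓ
  obtain ⟨v', hv'⟩ : ∃ v : HeightOneSpectrum (𝓞 K), ((ℓ : ℕ) : 𝓞 K) ∈ v.asIdeal :=
    ⟨⟨Ideal.span {((ℓ : ℕ) : 𝓞 K)}, hKolℓ.2.2.2.2.1, by
        rw [Ne, Ideal.span_singleton_eq_bot]; exact_mod_cast hℓp.ne_zero⟩,
      Ideal.mem_span_singleton_self _⟩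
  obtain ⟨hcloc, hwloc⟩ := hlocℓ v' hv'
  have hN : Squarefree (n * ℓ) :=
    (Nat.squarefree_mul ((Nat.Prime.coprime_iff_not_dvd hℓp).mpr hℓdvd).symm).mpr ⟨hn, hℓp.squarefree⟩
  have hN0 : n * ℓ ≠ 0 := hN.ne_zero
  have hNpf : (n * ℓ).primeFactors = n.primeFactors ∪ {ℓ} := by
    rw [Nat.primeFactors_mul hn0 hℓ0, hℓp.primeFactors]
  have hNK : ∀ q ∈ (n * ℓ).primeFactors, Zhang2014.IsKolyvaginPrime (W.conductorNorm ℤ) W K 2 q ∧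
      M + 1 ≤ Zhang2014.kolyvaginIndex W 2 q := by
    intro q hq
    rw [hNpf, Finset.mem_union, Finset.mem_singleton] at hq
    rcases hq with hq | rfl
    · exact hnK q hq
    · exact ⟨hKolℓ, hM1ℓ⟩
  have hNK' : ∀ q ∈ (n * ℓ).primeFactors, Zhang2014.IsKolyvaginPrime (W.conductorNorm ℤ) W K 2 q ∧
      M ≤ Zhang2014.kolyvaginIndex W 2 q :=
    fun q hq ↦ ⟨(hNK q hq).1, Nat.le_of_succ_le (hNK q hq).2⟩
  have hNKol : KolyvaginDescent.KolSupp (Zhang2014.IsKolyvaginPrime (W.conductorNorm ℤ) W K 2) (n * ℓ) :=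
    ⟨hN, fun q hq ↦ (hNK q hq).1⟩
  have hNcard : (n * ℓ).primeFactors.card = n.primeFactors.card + 1 := by
    rw [hNpf, Finset.card_union_of_disjoint (Finset.disjoint_singleton_right.mpr hℓn),
      Finset.card_singleton]
  have hn''eq : n / a * ℓ * a = n * ℓ := by rw [mul_right_comm, Nat.div_mul_cancel han]
  have ha'' : ¬ a ∣ n / a * ℓ := by
    intro h
    have : a * a ∣ n / a * ℓ * a := by
      rw [mul_comm (n / a * ℓ) a]; exact Nat.mul_dvd_mul_left a h
    rw [hn''eq] at this
    exact hap.one_lt.ne' (Nat.isUnit_iff.mp (hN a this))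
  have hD : NumberField.discr K < -4 := IsImaginaryQuadratic.discr_lt_neg_four_of_odd hK hodd hne3
  obtain ⟨d', d'', hσ, hS, hS', hemb, hσ₁, hS₁, hS₁', hemb₁⟩ :=
    Summit.BirchSwinnertonDyer.Rank1Residual.JET.exists_compatible_data_triple_of_grossCM (W := W) hK hD
      hHN 2 Dt β ι hn (fun q hq ↦ (hnK q hq).1) ha hKolℓ hℓn dat
  set C := d'.kolyvaginClass Nat.prime_two M with hC_def
  obtain ⟨-, hCsign⟩ := KolyvaginClassSign.sign_conjAct_kolyvaginClass_two hK hne3 hne4 hodd hHN hsur1 τ hτ1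
    Dt β ι hN hM1 hNK' d'
  have hCsign' : conjAct W τ ((2 ^ M : ℕ) : ℤ) C = ε' • C := by
    rw [hC_def, hCsign, hNcard, hε'_def, hεn_def, pow_succ]; ring_nf
  have hCF : C ∈ (selmerF W ((2 ^ M : ℕ) : ℤ) (𝒯 M) (placesDividing K (n * ℓ))).selmerGroup := by
    have h := zsmul_kolyvaginClass_mem_selmerF W Dt β ι 𝒯 (hK := hK) (hP4 := hP4) (hT2 := hT2) d' hNKol hM1
      (fun q hq ↦ (hNK q hq).2)
    rwa [pow_zero, Nat.cast_one, one_zsmul] at h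
  obtain ⟨hv'v₀, hv₀m, hv'm, hv₀N, hv'N, hmc, hcov⟩ :=
    swapPlaces (K := K) hn ha hKola.2.2.2.2.1 hℓp hKolℓ.2.2.2.2.1 hℓn hv₀ hv'
  have hwKum : galoisCohomology.localization ((W.baseChange K).torsionGaloisModule ((2 ^ M : ℕ) : ℤ)) (Sum.inr v') 1 w ∈
      (W.baseChange K).kummerSelmerStructure ((2 ^ M : ℕ) : ℤ) (Sum.inr v') := by
    have h := (SelmerStructure.mem_selmerGroup_iff _ w).mp hwF (Sum.inr v')
    rwa [relaxedAt_inr_of_ne W _ _ hv'v₀, selmerF_inr, if_neg hv'm] at h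
  have hwa : ((2 ^ (u - 1) : ℕ) : ℤ) •
      galoisCohomology.localization ((W.baseChange K).torsionGaloisModule ((2 ^ M : ℕ) : ℤ)) (Sum.inr v') 1 w ≠ 0 := by
    intro h0
    have h1 : ((2 ^ (u - 1) : ℕ) : ℤ) • w ∈ (W.baseChange K).torsionLocalKer (v'.adicCompletion K) ((2 ^ M : ℕ) : ℤ) :=
      (mem_torsionLocalKer_two_pow_iff W M v' _).mpr ((map_zsmul _ _ _).trans h0)
    have := (hwloc (u - 1)).mp h1
    omega
  have hcj : ((2 ^ (g - 1) : ℕ) : ℤ) • c ∉ (W.baseChange K).torsionLocalKer (v'.adicCompletion K) ((2 ^ M : ℕ) : ℤ) := by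
    intro h; have := (hcloc (g - 1)).mp h; omega
  have hQℓ := KolyvaginLowerTwo.kolyvaginRelationAtTwo_at_of_prop37_2 W Dt β ι hρ2 hK hne3 hne4 hHN h37 M hN hℓp hℓdvd hNK' dat d'
    hσ hS hS' hemb v' hv'
  have hCb : ((2 ^ (g - 1) : ℕ) : ℤ) •
      galoisCohomology.localization ((W.baseChange K).torsionGaloisModule ((2 ^ M : ℕ) : ℤ)) (Sum.inr v') 1 C ∉
      (W.baseChange K).kummerSelmerStructure ((2 ^ M : ℕ) : ℤ) (Sum.inr v') := by
    intro h
    have h1 : ((2 ^ (g - 1) : ℕ) : ℤ) • C ∈ selmerLocalKer (W.baseChange K) (v'.adicCompletion K) ((2 ^ M : ℕ) : ℤ) :=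
      (mem_selmerLocalKer_two_pow_iff W M v' _).mpr (mem_of_eq_of_mem_swap h (map_zsmul _ _ _))
    exact hcj ((hQℓ (g - 1)).2.mp ((hQℓ (g - 1)).1.mp h1))
  have hCT : galoisCohomology.localization ((W.baseChange K).torsionGaloisModule ((2 ^ M : ℕ) : ℤ)) (Sum.inr v₀) 1 C ∈
      𝒯 M (Sum.inr v₀) :=
    ((mem_selmerGroup_selmerF_iff W _ (𝒯 M) hN0 _).mp hCF).2 v₀ hv₀N
  have hwuT : ((2 ^ u : ℕ) : ℤ) •
      galoisCohomology.localization ((W.baseChange K).torsionGaloisModule ((2 ^ M : ℕ) : ℤ)) (Sum.inr v₀) 1 w ∈ 𝒯 M (Sum.inr v₀) := by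
    have : ((2 ^ u : ℕ) : ℤ) •
        galoisCohomology.localization ((W.baseChange K).torsionGaloisModule ((2 ^ M : ℕ) : ℤ)) (Sum.inr v₀) 1 w = 0 := by
      rw [← map_zsmul, hu0, map_zero]
    rw [this]; exact zero_mem _
  have hkey : ((2 ^ (g - 1) : ℕ) : ℤ) • C ∉ (W.baseChange K).torsionLocalKer (v₀.adicCompletion K) ((2 ^ M : ℕ) : ℤ) := by
    intro hker
    have hb₀ : ((2 ^ (g - 1) : ℕ) : ℤ) •
        galoisCohomology.localization ((W.baseChange K).torsionGaloisModule ((2 ^ M : ℕ) : ℤ)) (Sum.inr v₀) 1 C = 0 :=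
      (map_zsmul _ _ _).symm.trans ((mem_torsionLocalKer_two_pow_iff W M v₀ _).mp hker)
    have hB := hP7b M (M + k) a v₀ w C ε' u (g - 1) hε' hKola hidxa (by omega) haF hv₀ hwτ hCsign' hCT hwuT hb₀
    have hA := hP7a M (M + k) ℓ v' w C ε' (u - 1) (g - 1) hε' hKolℓ hMℓ (by omega) hfrob hv' hwτ hCsign' hwKum hwa hCb
      (by omega)
    have hsum := localTatePairing_add_eq_zero_of_swap W 2 M (e M) (hμ M) (hadd₁ M) (hadd₂ M) (hgal M)
      (halt M) (hnondeg M) hK hM1 (inv M) (fun v ↦ ((hperf M) v).1.injective) (hvan M) (𝒯 M)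
      (h𝒯sd M (n * ℓ)) hv'v₀.symm hcov hmc hv₀m hv₀N hv'N w C hwF hCF
    have hexp : u - 1 + (g - 1) - M = u + (g - 1) - M - 1 := by omega
    rw [hexp] at hA
    have h3 := congrArg (fun x : ZMod (2 ^ M) ↦ (2 ^ (u + (g - 1) - M - 1) : ℕ) • x) hsum
    simp only [smul_add, smul_zero] at h3
    rw [hB, zero_add] at h3
    exact hA h3
  have hQa := KolyvaginLowerTwo.kolyvaginRelationAtTwo_of_mul_eq W Dt β ι hρ2 hK hne3 hne4 hHN h37 M hn''eq hN hap ha'' hNK' d'' d'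
    hσ₁ hS₁ hS₁' hemb₁ v₀ hv₀ (g - 1)
  have hkey'' : ((2 ^ (g - 1) : ℕ) : ℤ) • d''.kolyvaginClass Nat.prime_two M ∉
      (W.baseChange K).torsionLocalKer (v₀.adicCompletion K) ((2 ^ M : ℕ) : ℤ) := fun h ↦ hkey (hQa.2.mpr h)
  have hne'' : ((2 ^ (g - 1) : ℕ) : ℤ) • d''.kolyvaginClass Nat.prime_two M ≠ 0 :=
    fun h ↦ hkey'' (by rw [h]; exact zero_mem _)
  refine ⟨ℓ, hℓX, hℓn, hKolℓ, hIℓ, hfrob, fun v hv ↦ ?_, d'', hne''⟩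
  intro h
  have := ((hlocℓ v hv).1 (g - 1)).mp h
  omega

end Frame

end Summit.BirchSwinnertonDyer.BirchSwinnertonDyer.Theorems.KolyvaginLowerTwo

end
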